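import Mathlib.Topology.Order.IntermediateValue
import Literature.Analysis.FluidPDE.CompressibleEulerImplosionShootingTube
import Literature.Analysis.FluidPDE.CompressibleEulerImplosionP0Uniform
import Literature.Analysis.FluidPDE.CompressibleEulerImplosionGermContinuity
import Literature.Analysis.FluidPDE.CompressibleEulerImplosionBranchUniform
import Literature.Analysis.FluidPDE.CompressibleEulerImplosionRightU
import Literature.Analysis.FluidPDE.CompressibleEulerImplosionRightD
import Literature.Analysis.FluidPDE.CompressibleEulerImplosionShootingGlue
import Literature.Analysis.FluidPDE.CompressibleEulerImplosionP0ToPs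
import HarnessLib

/-!
# Buckmaster–Cao-Labora–Gómez-Serrano at γ = 5/3: the shooting argument (§6)

Section 6 of the paper at `γ = 5/3`: on the window `r ∈ [r_d, r_u] ⊂ (r₃, r₄)` (the two values of
`CompressibleEulerImplosionRightD/RightU`) the trajectory issued from `P₀` (Prop. 2.5, in the
uniform form of `CompressibleEulerImplosionP0Uniform`) is compared with the analytic branch
through `P_s` at the branch time `s < 0` (a point of the branch just to the right of `P_s`):
`e(r) = Z_traj − Z_branch` at the common abscissa `W = W^{(r)}(s)`. By the right barriers,
`e(r_u) < 0 < e(r_d)`; by continuous dependence on `r` (the tube estimate of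
`CompressibleEulerImplosionShootingTube`, the continuity of the far-field germ and of the branch
in `r`) `e` is continuous, so it vanishes at some `r ∈ [r_d, r_u]`: there the `P₀` trajectory
MEETS the branch (`exists_meeting`). Combined with `thm11_monatomic_of_meeting` this proves
Theorem 1.1 at `γ = 5/3` given Proposition 3.1 (the continuation of the branch to the left of
`P_s` down to `P_∞`) on the window (`thm11_monatomic_of_left`).

[cite: BuckmasterCaolaboraGomezserrano2025, §6 (proof of Theorem 1.1), Prop. 4.1, Prop. 2.5, Prop. 3.1]
-/

noncomputable section

open Set Filter Topology

namespace Literature.Analysis.FluidPDE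

namespace BuckmasterCaolaboraGomezserrano2025

namespace Monatomic

namespace Shooting

open SonicSeries Germ Tube OriginSeries

/-! ### The window `[r_d, r_u]` -/

/-- `r_d`. [cite: BuckmasterCaolaboraGomezserrano2025, Prop. 4.1] -/
def rd : ℝ := RightD.ru

/-- `r_u`. [cite: BuckmasterCaolaboraGomezserrano2025, Prop. 4.1] -/
def ru : ℝ := RightU.ru

/-- [folklore] -/
theorem rd_eq : rd = 17307 / 15625 := rfl

/-- [folklore] -/
theorem ru_eq : ru = 89409 / 80000 := rfl

/-- [folklore] -/
theorem rd_lt_ru : rd < ru := by rw [rd_eq, ru_eq]; norm_num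

/-- [folklore] -/
theorem rd_le_ru : rd ≤ ru := rd_lt_ru.le

/-- [folklore] -/
theorem r3_lt_rd : r3 < rd := RightD.ru_mem.1

/-- [folklore] -/
theorem ru_lt_r4 : ru < r4 := RightU.ru_mem.2

/-- [folklore] -/
theorem window {r : ℝ} (hr : r ∈ Icc rd ru) :
    11 / 10 ≤ r ∧ r ≤ 28 / 25 ∧ r3 < r ∧ r < r4 ∧ |r| ≤ 2 := by
  rw [rd_eq, ru_eq] at hr
  obtain ⟨h1, h2⟩ := hr
  refine ⟨by linarith, by linarith, r3_lt_rd.trans_le (by rw [rd_eq]; exact h1),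
    lt_of_le_of_lt (by rw [ru_eq]; exact h2) ru_lt_r4, abs_le.mpr ⟨by linarith, by linarith⟩⟩

/-! ### The family of `P₀` trajectories -/

/-- The arrival time at `P_s` of the `P₀` trajectory. [cite: BuckmasterCaolaboraGomezserrano2025, Prop. 2.5] -/
def bT (r : ℝ) : ℝ :=
  if h : 11 / 10 ≤ r ∧ r ≤ 28 / 25 then Classical.choose (exists_P0_trajectory_unif h.1 h.2) else 0

/-- The `P₀` trajectory (anchored: equal to the explicit germ for `ξ ≤ ξ_A − 1`).
[cite: BuckmasterCaolaboraGomezserrano2025, Prop. 2.5] -/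
def traj (r : ℝ) : ℝ → ℝ × ℝ :=
  if h : 11 / 10 ≤ r ∧ r ≤ 28 / 25 then
    Classical.choose (Classical.choose_spec (exists_P0_trajectory_unif h.1 h.2)).2 else fun _ => 0

/-- [cite: BuckmasterCaolaboraGomezserrano2025, Prop. 2.5] -/
theorem traj_spec {r : ℝ} (h1 : 11 / 10 ≤ r) (h2 : r ≤ 28 / 25) :
    ξA - 1 < bT r ∧
      (∀ ξ : ℝ, ξ ≤ ξA - 1 → traj r ξ = germ r ξ) ∧
      (∀ ξ ∈ Iio (bT r), HasDerivAt (traj r) (field r (traj r ξ)) ξ) ∧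
      (∀ ξ ∈ Iio (bT r), 0 < DW (traj r ξ).1 (traj r ξ).2 ∧ DZ (traj r ξ).1 (traj r ξ).2 < 0 ∧
        (traj r ξ).2 < (traj r ξ).1) ∧
      (∀ ξ ∈ Iio (bT r), NW r (traj r ξ).1 (traj r ξ).2 < 0) ∧
      StrictAntiOn (fun ξ => (traj r ξ).1) (Iio (bT r)) ∧
      Tendsto (traj r) (𝓝[<] (bT r)) (𝓝 (W0 r, Z0 r)) := by
  have h : 11 / 10 ≤ r ∧ r ≤ 28 / 25 := ⟨h1, h2⟩
  simp only [bT, traj, dif_pos h]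
  exact ⟨(Classical.choose_spec (exists_P0_trajectory_unif h.1 h.2)).1,
    Classical.choose_spec (Classical.choose_spec (exists_P0_trajectory_unif h.1 h.2)).2⟩

variable {r : ℝ}

/-- `W > W₀` along the whole `P₀` trajectory. [cite: BuckmasterCaolaboraGomezserrano2025, Prop. 2.5] -/
theorem W0_lt_traj (h1 : 11 / 10 ≤ r) (h2 : r ≤ 28 / 25) {ξ : ℝ} (hξ : ξ < bT r) :
    W0 r < (traj r ξ).1 := by
  obtain ⟨_, _, hode, _, _, hanti, htend⟩ := traj_spec h1 h2
  obtain ⟨ξ₂, hξ₂, hξ₂b⟩ := exists_between hξ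
  have hlt : (traj r ξ₂).1 < (traj r ξ).1 := hanti hξ hξ₂b hξ₂
  -- `W(ξ₂) ≥ W₀` from the limit
  have hW : Tendsto (fun u => (traj r u).1) (𝓝[<] (bT r)) (𝓝 (W0 r)) :=
    (continuous_fst.tendsto _).comp htend
  have hev : ∀ᶠ u in 𝓝[<] (bT r), (traj r u).1 ≤ (traj r ξ₂).1 := by
    filter_upwards [Ioo_mem_nhdsLT hξ₂b] with u hu
    exact (hanti hξ₂b hu.2 hu.1).le
  have hge : W0 r ≤ (traj r ξ₂).1 := le_of_tendsto hW hev
  linarith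

/-! ### The branch data: the branch time `s` -/

/-- **Choice of the branch time `s < 0`**, uniformly good on the window and below the thresholds of
the two right barriers. [cite: BuckmasterCaolaboraGomezserrano2025, §6] -/
theorem exists_s : ∃ s : ℝ, s < 0 ∧
    (∀ r ∈ Icc rd ru, |s| < sonicRad r ∧
      (∀ t : ℝ, s ≤ t → t < 0 → 0 < DW (Wloc r t) (Zloc r t) ∧ DZ (Wloc r t) (Zloc r t) < 0 ∧
        Zloc r t < Wloc r t ∧ W0 r < Wloc r t ∧ |Wloc r t - W0 r| ≤ 1 / 4)) ∧
    ContinuousOn (fun r => Wloc r s) (Icc rd ru) ∧ ContinuousOn (fun r => Zloc r s) (Icc rd ru) ∧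
    RightU.bar (Wloc ru s) < Zloc ru s ∧ Zloc rd s < RightD.bar (Wloc rd s) := by
  obtain ⟨δ, hδ, hbr⟩ := branch_uniform r3_lt_rd ru_lt_r4 rd_le_ru
  obtain ⟨ρ, hρ, hρle, hcW, hcZ⟩ := continuousOn_Wloc_Zloc r3_lt_rd ru_lt_r4 rd_le_ru
  obtain ⟨εu, hεu, hu⟩ := Metric.eventually_nhds_iff.mp (eventually_nhdsWithin_iff.mp RightU.branch_vs_bar)
  obtain ⟨εd, hεd, hd⟩ := Metric.eventually_nhds_iff.mp (eventually_nhdsWithin_iff.mp RightD.branch_vs_bar)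
  set σ : ℝ := min (min δ (ρ / 2)) (min (εu / 2) (εd / 2)) with hσ
  have hσpos : 0 < σ := by positivity
  have hσδ : σ ≤ δ := (min_le_left _ _).trans (min_le_left _ _)
  have hσρ : σ < ρ := lt_of_le_of_lt ((min_le_left _ _).trans (min_le_right _ _)) (by linarith)
  have hσu : σ < εu := lt_of_le_of_lt ((min_le_right _ _).trans (min_le_left _ _)) (by linarith)
  have hσd : σ < εd := lt_of_le_of_lt ((min_le_right _ _).trans (min_le_right _ _)) (by linarith)
  refine ⟨-σ, by linarith, fun r hr => ⟨?_, fun t ht1 ht2 => ?_⟩, ?_, ?_, ?_, ?_⟩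
  · rw [abs_neg, abs_of_pos hσpos]
    exact lt_of_le_of_lt hσδ (hbr r hr).1
  · have hta : |t| ≤ δ := by rw [abs_of_neg ht2]; linarith
    obtain ⟨⟨kDW, kZW, kW, _⟩, kneg, _⟩ := (hbr r hr).2 t hta
    exact ⟨kDW, (kneg ht2).1, kZW, (kneg ht2).2, kW⟩
  · refine hcW.comp (continuousOn_id.prodMk continuousOn_const) fun r hr => ⟨hr, ?_⟩
    simp only [Metric.mem_ball, dist_zero_right, norm_neg, Real.norm_eq_abs, abs_of_pos hσpos]
    exact hσρ
  · refine hcZ.comp (continuousOn_id.prodMk continuousOn_const) fun r hr => ⟨hr, ?_⟩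
    simp only [Metric.mem_ball, dist_zero_right, norm_neg, Real.norm_eq_abs, abs_of_pos hσpos]
    exact hσρ
  · exact hu (by rw [dist_zero_right, norm_neg, Real.norm_eq_abs, abs_of_pos hσpos]; exact hσu)
      (by show -σ < 0; linarith)
  · exact hd (by rw [dist_zero_right, norm_neg, Real.norm_eq_abs, abs_of_pos hσpos]; exact hσd)
      (by show -σ < 0; linarith)

/-- The branch time of the comparison. [cite: BuckmasterCaolaboraGomezserrano2025, §6] -/
def s0 : ℝ := Classical.choose exists_s

/-- [cite: BuckmasterCaolaboraGomezserrano2025, §6] -/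
theorem s0_spec : s0 < 0 ∧
    (∀ r ∈ Icc rd ru, |s0| < sonicRad r ∧
      (∀ t : ℝ, s0 ≤ t → t < 0 → 0 < DW (Wloc r t) (Zloc r t) ∧ DZ (Wloc r t) (Zloc r t) < 0 ∧
        Zloc r t < Wloc r t ∧ W0 r < Wloc r t ∧ |Wloc r t - W0 r| ≤ 1 / 4)) ∧
    ContinuousOn (fun r => Wloc r s0) (Icc rd ru) ∧ ContinuousOn (fun r => Zloc r s0) (Icc rd ru) ∧
    RightU.bar (Wloc ru s0) < Zloc ru s0 ∧ Zloc rd s0 < RightD.bar (Wloc rd s0) :=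
  Classical.choose_spec exists_s

/-- The comparison abscissa `W* = W^{(r)}(s₀)` lies in `(W₀, 3)`. [folklore] -/
theorem Wstar_bounds (hr : r ∈ Icc rd ru) : W0 r < Wloc r s0 ∧ Wloc r s0 < 3 := by
  obtain ⟨hs, hall, _⟩ := s0_spec
  obtain ⟨_, h⟩ := hall r hr
  obtain ⟨_, _, _, hW0, hW⟩ := h s0 le_rfl hs
  obtain ⟨h1, h2, _, h4, _⟩ := window hr
  have hq := Germ.q_le h1 h2
  have hab := (abs_le.mp hW).2
  refine ⟨hW0, ?_⟩
  unfold W0 at hab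
  linarith

/-! ### The crossing time `θ(r)` and the shooting function `e(r)` -/

/-- **Existence of the crossing**: the `P₀` trajectory reaches the abscissa `W*` at some time in
`(ξ_A − 1, b)`. [cite: BuckmasterCaolaboraGomezserrano2025, §6] -/
theorem exists_crossing (hr : r ∈ Icc rd ru) :
    ∃ θ : ℝ, ξA - 1 < θ ∧ θ < bT r ∧ (traj r θ).1 = Wloc r s0 := by
  obtain ⟨h1, h2, _⟩ := window hr
  obtain ⟨hab, hgerm, hode, _, _, hanti, htend⟩ := traj_spec h1 h2
  obtain ⟨hW0, hW3⟩ := Wstar_bounds hr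
  set a := ξA - 1 with ha
  have hWa : 20 ≤ (traj r a).1 := by rw [hgerm a le_rfl]; exact (germ_anchor h1 h2).1
  -- a time close to `b` where `W < W*`
  have hWt : Tendsto (fun u => (traj r u).1) (𝓝[<] (bT r)) (𝓝 (W0 r)) :=
    (continuous_fst.tendsto _).comp htend
  have hev : ∀ᶠ u in 𝓝[<] (bT r), (traj r u).1 < Wloc r s0 := hWt (Iio_mem_nhds hW0)
  obtain ⟨ξ', ⟨hξ'lt, haξ'⟩⟩ := (hev.and (Ioo_mem_nhdsLT hab)).exists
  -- IVT on `[a, ξ']`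
  have hcont : ContinuousOn (fun u => (traj r u).1) (Icc a ξ') := fun u hu =>
    ((hode u (lt_of_le_of_lt hu.2 haξ'.2)).continuousAt.fst).continuousWithinAt
  have hmem : Wloc r s0 ∈ Icc ((traj r ξ').1) ((traj r a).1) := ⟨hξ'lt.le, by linarith⟩
  obtain ⟨θ, hθ, hθW⟩ := intermediate_value_Icc' haξ'.1.le hcont hmem
  refine ⟨θ, ?_, lt_of_le_of_lt hθ.2 haξ'.2, hθW⟩
  rcases eq_or_lt_of_le hθ.1 with h | h
  · exfalso; rw [← h] at hθW; simp only at hθW; linarith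
  · exact h

/-- The crossing time. [cite: BuckmasterCaolaboraGomezserrano2025, §6] -/
def θ (r : ℝ) : ℝ := if h : r ∈ Icc rd ru then Classical.choose (exists_crossing h) else 0

/-- [cite: BuckmasterCaolaboraGomezserrano2025, §6] -/
theorem θ_spec (hr : r ∈ Icc rd ru) : ξA - 1 < θ r ∧ θ r < bT r ∧ (traj r (θ r)).1 = Wloc r s0 := by
  simp only [θ, dif_pos hr]
  exact Classical.choose_spec (exists_crossing hr)

/-- Uniqueness of the crossing time. [folklore] -/
theorem eq_θ (hr : r ∈ Icc rd ru) {t : ℝ} (ht : t < bT r) (hW : (traj r t).1 = Wloc r s0) : t = θ r := by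
  obtain ⟨h1, h2, _⟩ := window hr
  obtain ⟨_, hθb, hθW⟩ := θ_spec hr
  have hanti := (traj_spec h1 h2).2.2.2.2.2.1
  exact hanti.injOn ht hθb (hW.trans hθW.symm)

/-- **The shooting function** `e(r) = Z_traj(θ(r)) − Z^{(r)}(s₀)`. [cite: BuckmasterCaolaboraGomezserrano2025, §6] -/
def e (r : ℝ) : ℝ := (traj r (θ r)).2 - Zloc r s0

/-! ### The signs of `e` at `r_u` and `r_d` (the right barriers) -/

/-- [folklore] -/
theorem ru_mem_window : ru ∈ Icc rd ru := ⟨rd_le_ru, le_rfl⟩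

/-- [folklore] -/
theorem rd_mem_window : rd ∈ Icc rd ru := ⟨le_rfl, rd_le_ru⟩

/-- **`e(r_u) < 0`**: at `r = r_u` the `P₀` trajectory passes below the branch.
[cite: BuckmasterCaolaboraGomezserrano2025, Prop. 4.1, §6] -/
theorem e_ru_neg : e ru < 0 := by
  have hr := ru_mem_window
  obtain ⟨h1, h2, _⟩ := window hr
  obtain ⟨hab, hgerm, hode, hΩ, _, hanti, _⟩ := traj_spec h1 h2
  obtain ⟨haθ, hθb, hθW⟩ := θ_spec hr
  obtain ⟨hWa, hDZa, _⟩ := germ_anchor h1 h2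
  set a := ξA - 1 with ha
  -- the barrier on `[a, T']`, `T' ∈ (θ, b)`
  obtain ⟨T', hθT', hT'b⟩ := exists_between hθb
  have key := RightU.barrier (c := traj ru) (a := a) (T := T')
    (fun ξ hξ => hode ξ (lt_trans hξ.2 hT'b))
    (fun ξ hξ => ⟨(hΩ ξ (lt_trans hξ.2 hT'b)).1, (hΩ ξ (lt_trans hξ.2 hT'b)).2.1⟩)
    (fun ξ hξ => W0_lt_traj h1 h2 (lt_trans hξ.2 hT'b))
    (by rw [hgerm a le_rfl]; exact RightU.below_of_far (by linarith) hDZa)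
    (θ ru) ⟨haθ.le, hθT'⟩
  rw [hθW] at key
  have hb := s0_spec.2.2.2.2.1
  show (traj ru (θ ru)).2 - Zloc ru s0 < 0
  linarith

/-- **`e(r_d) > 0`**: at `r = r_d` the `P₀` trajectory passes above the branch.
[cite: BuckmasterCaolaboraGomezserrano2025, Prop. 4.1, §6] -/
theorem e_rd_pos : 0 < e rd := by
  have hr := rd_mem_window
  obtain ⟨h1, h2, _⟩ := window hr
  obtain ⟨hab, hgerm, hode, hΩ, _, hanti, _⟩ := traj_spec h1 h2
  obtain ⟨haθ, hθb, hθW⟩ := θ_spec hr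
  obtain ⟨hWa, _, hDWa⟩ := germ_anchor h1 h2
  set a := ξA - 1 with ha
  obtain ⟨T', hθT', hT'b⟩ := exists_between hθb
  have key := RightD.barrier (c := traj rd) (a := a) (T := T')
    (fun ξ hξ => hode ξ (lt_trans hξ.2 hT'b))
    (fun ξ hξ => ⟨(hΩ ξ (lt_trans hξ.2 hT'b)).1, (hΩ ξ (lt_trans hξ.2 hT'b)).2.1⟩)
    (fun ξ hξ => W0_lt_traj h1 h2 (lt_trans hξ.2 hT'b))
    (by rw [hgerm a le_rfl]; exact RightD.above_of_far (by linarith) hDWa)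
    (θ rd) ⟨haθ.le, hθT'⟩
  rw [hθW] at key
  have hb := s0_spec.2.2.2.2.2
  show 0 < (traj rd (θ rd)).2 - Zloc rd s0
  linarith

/-! ### Continuity of the shooting function (continuous dependence on `r`) -/

/-- [folklore] -/
theorem Klip_pos {m R : ℝ} (hm : 0 < m) (hR : 1 ≤ R) : 0 < Klip m R := by
  unfold Klip; positivity
set_option maxHeartbeats 400000 in -- buildfix (bf3-g27): 160k/180k FAIL, 200k PASS at accept time; line-neutral budget line
/-- **Continuity of `e` on the window.** [cite: BuckmasterCaolaboraGomezserrano2025, §6] -/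
theorem continuousOn_e : ContinuousOn e (Icc rd ru) := by
  intro r0 hr0
  rw [Metric.continuousWithinAt_iff]
  intro ε hε
  obtain ⟨h1, h2, _, _, habs⟩ := window hr0
  obtain ⟨hab0, hgerm0, hode0, hΩ0, _, hanti0, _⟩ := traj_spec h1 h2
  obtain ⟨haθ0, hθb0, hθW0⟩ := θ_spec hr0
  set a := ξA - 1 with ha
  set θ0 := θ r0 with hθ0
  set f := traj r0 with hf
  obtain ⟨T1, hθT1, hT1b⟩ := exists_between hθb0
  have haT1 : a ≤ T1 := by linarith
  -- Step 1: margins of `f` on `[a, T1]`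
  have hfc : ContinuousOn f (Icc a T1) := fun u hu =>
    (hode0 u (lt_of_le_of_lt hu.2 hT1b)).continuousAt.continuousWithinAt
  have hcpt : IsCompact (Icc a T1) := isCompact_Icc
  have hne : (Icc a T1).Nonempty := nonempty_Icc.mpr haT1
  have hgc1 : ContinuousOn (fun u => DW (f u).1 (f u).2) (Icc a T1) := continuous_DW.comp_continuousOn hfc
  have hgc2 : ContinuousOn (fun u => -DZ (f u).1 (f u).2) (Icc a T1) :=
    (continuous_DZ.comp_continuousOn hfc).neg
  obtain ⟨u1, hu1, hmin1⟩ := hcpt.exists_isMinOn hne hgc1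
  obtain ⟨u2, hu2, hmin2⟩ := hcpt.exists_isMinOn hne hgc2
  set m := min (DW (f u1).1 (f u1).2) (-DZ (f u2).1 (f u2).2) / 2 with hm
  have hΩu1 := hΩ0 u1 (lt_of_le_of_lt hu1.2 hT1b)
  have hΩu2 := hΩ0 u2 (lt_of_le_of_lt hu2.2 hT1b)
  have hm0 : 0 < m := by
    have : 0 < min (DW (f u1).1 (f u1).2) (-DZ (f u2).1 (f u2).2) :=
      lt_min hΩu1.1 (by linarith [hΩu2.2.1])
    simp only [hm]; linarith
  have hml1 : 2 * m ≤ DW (f u1).1 (f u1).2 := by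
    have := min_le_left (DW (f u1).1 (f u1).2) (-DZ (f u2).1 (f u2).2); simp only [hm]; linarith
  have hml2 : 2 * m ≤ -DZ (f u2).1 (f u2).2 := by
    have := min_le_right (DW (f u1).1 (f u1).2) (-DZ (f u2).1 (f u2).2); simp only [hm]; linarith
  obtain ⟨C, hC⟩ := hcpt.exists_bound_of_continuousOn hfc
  set R := max C 0 + 2 with hR
  have hR1 : 1 ≤ R := by simp only [hR]; linarith [le_max_right C 0]
  have hfs : ∀ u ∈ Icc a T1, 2 * m ≤ DW (f u).1 (f u).2 ∧ DZ (f u).1 (f u).2 ≤ -2 * m ∧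
      |(f u).1| ≤ R - 1 ∧ |(f u).2| ≤ R - 1 := by
    intro u hu
    have h1' : DW (f u1).1 (f u1).2 ≤ DW (f u).1 (f u).2 := hmin1 hu
    have h2' : -DZ (f u2).1 (f u2).2 ≤ -DZ (f u).1 (f u).2 := hmin2 hu
    have hn := hC u hu
    have hn1 : |(f u).1| ≤ C := by
      have := norm_fst_le (f u); rw [Real.norm_eq_abs] at this; exact this.trans hn
    have hn2 : |(f u).2| ≤ C := by
      have := norm_snd_le (f u); rw [Real.norm_eq_abs] at this; exact this.trans hn
    have hCR : C ≤ R - 1 := by simp only [hR]; linarith [le_max_left C 0]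
    refine ⟨by linarith, by linarith, hn1.trans hCR, hn2.trans hCR⟩
  -- Step 2: localisation of the crossing time of `f`
  have hfθ : ContinuousAt f θ0 := (hode0 θ0 hθb0).continuousAt
  obtain ⟨ε1', hε1', hosc⟩ := Metric.continuousAt_iff.mp hfθ (ε / 3) (by positivity)
  set ε1 := min (ε1' / 2) (min ((T1 - θ0) / 2) ((θ0 - a) / 2)) with hε1
  have hε10 : 0 < ε1 := by
    simp only [hε1]
    refine lt_min (by linarith) (lt_min (by linarith) (by linarith))
  have hε1a : ε1 < ε1' := lt_of_le_of_lt (min_le_left _ _) (by linarith)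
  have hmr := min_le_right (ε1' / 2) (min ((T1 - θ0) / 2) ((θ0 - a) / 2))
  have hm1 := min_le_left ((T1 - θ0) / 2) ((θ0 - a) / 2)
  have hm2 := min_le_right ((T1 - θ0) / 2) ((θ0 - a) / 2)
  have hε1T : θ0 + ε1 < T1 := by simp only [hε1]; linarith
  have hε1b : a < θ0 - ε1 := by simp only [hε1]; linarith
  have hmemm : θ0 - ε1 ∈ Iio (bT r0) := show θ0 - ε1 < bT r0 by linarith
  have hmemp : θ0 + ε1 ∈ Iio (bT r0) := show θ0 + ε1 < bT r0 by linarith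
  have hWm : Wloc r0 s0 < (f (θ0 - ε1)).1 := by
    rw [← hθW0]; exact hanti0 hmemm hθb0 (by linarith)
  have hWp : (f (θ0 + ε1)).1 < Wloc r0 s0 := by
    rw [← hθW0]; exact hanti0 hθb0 hmemp (by linarith)
  set gap := min ((f (θ0 - ε1)).1 - Wloc r0 s0) (Wloc r0 s0 - (f (θ0 + ε1)).1) with hgap
  have hgap0 : 0 < gap := lt_min (by linarith) (by linarith)
  have hgap1 : gap ≤ (f (θ0 - ε1)).1 - Wloc r0 s0 := min_le_left _ _
  have hgap2 : gap ≤ Wloc r0 s0 - (f (θ0 + ε1)).1 := min_le_right _ _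
  -- the closeness `η`
  set η := min (min m 1) (min (gap / 2) (ε / 3)) with hη
  have hη0 : 0 < η := lt_min (lt_min hm0 one_pos) (lt_min (by linarith) (by linarith))
  have hηm : η ≤ m := (min_le_left _ _).trans (min_le_left _ _)
  have hη1 : η ≤ 1 := (min_le_left _ _).trans (min_le_right _ _)
  have hηg : η ≤ gap / 2 := (min_le_right _ _).trans (min_le_left _ _)
  have hηε : η ≤ ε / 3 := (min_le_right _ _).trans (min_le_right _ _)
  -- Step 3: the Grönwall bound is small for `r` near `r0`
  set K := Klip m R with hK
  have hK0 : 0 < K := Klip_pos hm0 hR1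
  set A := Real.exp (K * (T1 - a)) with hA
  have hA0 : 0 < A := Real.exp_pos _
  have hA1 : 1 ≤ A := Real.one_le_exp (by positivity)
  set B := (R / m) / K * (A - 1) with hB
  have hB0 : 0 ≤ B := by simp only [hB]; apply mul_nonneg (by positivity) (by linarith)
  -- initial data: continuity of the germ at `a`
  have hgc : ContinuousWithinAt (fun r => germ r a) (Icc (11 / 10) (28 / 25)) r0 :=
    continuousOn_germ (by simp only [ha]; unfold ξA; norm_num) r0 ⟨h1, h2⟩
  obtain ⟨δg, hδg, hg⟩ := Metric.continuousWithinAt_iff.mp hgc (η / (2 * A)) (by positivity)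
  -- the branch data at `s0`
  obtain ⟨_, _, hcW, hcZ, _⟩ := s0_spec
  obtain ⟨δW, hδW, hWc⟩ := Metric.continuousWithinAt_iff.mp (hcW r0 hr0) (gap / 2) (by positivity)
  obtain ⟨δZ, hδZ, hZc⟩ := Metric.continuousWithinAt_iff.mp (hcZ r0 hr0) (ε / 3) (by positivity)
  set δr := min (min δg (η / (2 * (B + 1)))) (min δW δZ) with hδr
  have hδr0 : 0 < δr := lt_min (lt_min hδg (by positivity)) (lt_min hδW hδZ)
  refine ⟨δr, hδr0, fun r hr hdist => ?_⟩
  have hdg : dist r r0 < δg := lt_of_lt_of_le hdist ((min_le_left _ _).trans (min_le_left _ _))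
  have hdB : dist r r0 < η / (2 * (B + 1)) := lt_of_lt_of_le hdist ((min_le_left _ _).trans (min_le_right _ _))
  have hdW : dist r r0 < δW := lt_of_lt_of_le hdist ((min_le_right _ _).trans (min_le_left _ _))
  have hdZ : dist r r0 < δZ := lt_of_lt_of_le hdist ((min_le_right _ _).trans (min_le_right _ _))
  obtain ⟨k1, k2, _, _, _⟩ := window hr
  obtain ⟨hab, hgerm, hode, _, _, hanti, htend⟩ := traj_spec k1 k2
  obtain ⟨_, hθb, hθW⟩ := θ_spec hr
  -- the initial distance and the perturbation
  have hδ0 : dist (f a) (traj r a) < η / (2 * A) := by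
    rw [hgerm0 a le_rfl, hgerm a le_rfl, dist_comm]; exact hg ⟨k1, k2⟩ hdg
  have hbound : gronwallBound (dist (f a) (traj r a)) K (|r - r0| * (R / m)) (T1 - a) < η := by
    rw [gronwallBound_of_K_ne_0 hK0.ne']
    show dist (f a) (traj r a) * Real.exp (K * (T1 - a)) + |r - r0| * (R / m) / K * (Real.exp (K * (T1 - a)) - 1) < η
    rw [← hA]
    have e1 : |r - r0| * (R / m) / K * (A - 1) = |r - r0| * B := by simp only [hB]; ring
    rw [e1]
    have hrr : |r - r0| < η / (2 * (B + 1)) := by rw [← Real.dist_eq]; exact hdB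
    have t1 : dist (f a) (traj r a) * A < η / 2 := by
      have := (lt_div_iff₀ (by positivity : (0 : ℝ) < 2 * A)).mp hδ0
      linarith
    have t2 : |r - r0| * B ≤ η / 2 := by
      have hB1 : 0 < B + 1 := by linarith
      calc |r - r0| * B ≤ η / (2 * (B + 1)) * B := by gcongr
        _ ≤ η / (2 * (B + 1)) * (B + 1) := by gcongr; linarith
        _ = η / 2 := by field_simp
    linarith
  -- the tube estimate
  obtain ⟨hT1g, hclose⟩ := tube_estimate (f := f) (g := traj r) (P := (W0 r, Z0 r)) habs haT1 hT1b hab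
    hode0 hode htend (DZ_Ps r) hm0 hR1 hη0 hηm hη1 hfs hbound
  have hclose' : ∀ u ∈ Icc a T1, dist (f u) (traj r u) < η := fun u hu =>
    (hclose u hu).trans_lt ((gronwallBound_mono dist_nonneg (by positivity) hK0.le
      (by linarith [hu.2] : u - a ≤ T1 - a)).trans_lt hbound)
  -- Step 4: the crossing time of `traj r` is within `ε1` of `θ0`
  have hWr : |Wloc r s0 - Wloc r0 s0| < gap / 2 := by rw [← Real.dist_eq]; exact hWc hr hdW
  have hZr : |Zloc r s0 - Zloc r0 s0| < ε / 3 := by rw [← Real.dist_eq]; exact hZc hr hdZ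
  obtain ⟨hWr1, hWr2⟩ := abs_lt.mp hWr
  have hcm := hclose' (θ0 - ε1) ⟨hε1b.le, by linarith⟩
  have hcp := hclose' (θ0 + ε1) ⟨by linarith, hε1T.le⟩
  have hcm1 : |(f (θ0 - ε1)).1 - (traj r (θ0 - ε1)).1| < η := by
    rw [← Real.dist_eq]; exact lt_of_le_of_lt (by rw [Prod.dist_eq]; exact le_max_left _ _) hcm
  have hcp1 : |(f (θ0 + ε1)).1 - (traj r (θ0 + ε1)).1| < η := by
    rw [← Real.dist_eq]; exact lt_of_le_of_lt (by rw [Prod.dist_eq]; exact le_max_left _ _) hcp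
  obtain ⟨hcm1a, hcm1b⟩ := abs_lt.mp hcm1
  obtain ⟨hcp1a, hcp1b⟩ := abs_lt.mp hcp1
  have hlt1 : (traj r (θ r)).1 < (traj r (θ0 - ε1)).1 := by rw [hθW]; linarith
  have hlt2 : (traj r (θ0 + ε1)).1 < (traj r (θ r)).1 := by rw [hθW]; linarith
  have hm_r : θ0 - ε1 ∈ Iio (bT r) := show θ0 - ε1 < bT r by linarith
  have hp_r : θ0 + ε1 ∈ Iio (bT r) := show θ0 + ε1 < bT r by linarith
  have hθ1 : θ0 - ε1 < θ r := (StrictAntiOn.lt_iff_gt hanti hθb hm_r).mp hlt1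
  have hθ2 : θ r < θ0 + ε1 := (StrictAntiOn.lt_iff_gt hanti hp_r hθb).mp hlt2
  -- Step 5: the estimate of `e r - e r0`
  have hθmem : θ r ∈ Icc a T1 := ⟨by linarith, by linarith⟩
  have hd1 : |(traj r (θ r)).2 - (f (θ r)).2| < η := by
    rw [← Real.dist_eq, dist_comm]
    exact lt_of_le_of_lt (by rw [Prod.dist_eq]; exact le_max_right _ _) (hclose' _ hθmem)
  have hd2 : |(f (θ r)).2 - (f θ0).2| < ε / 3 := by
    have hdθ : dist (θ r) θ0 < ε1' := by
      rw [Real.dist_eq, abs_lt]; constructor <;> linarith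
    have := hosc hdθ
    rw [← Real.dist_eq]
    exact lt_of_le_of_lt (by rw [Prod.dist_eq]; exact le_max_right _ _) this
  obtain ⟨hd1a, hd1b⟩ := abs_lt.mp hd1
  obtain ⟨hd2a, hd2b⟩ := abs_lt.mp hd2
  obtain ⟨hZr1, hZr2⟩ := abs_lt.mp hZr
  rw [Real.dist_eq, abs_lt]
  unfold e
  constructor <;> linarith

/-! ### The meeting and Theorem 1.1 given the left side -/

/-- **The shooting succeeds**: for some `r ∈ [r_d, r_u]` the `P₀` trajectory meets the branch through
`P_s` at the branch time `s₀ < 0`. [cite: BuckmasterCaolaboraGomezserrano2025, §6 (proof of Theorem 1.1)] -/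
theorem exists_meeting : ∃ r ∈ Icc rd ru, traj r (θ r) = (Wloc r s0, Zloc r s0) := by
  have h := intermediate_value_Icc' rd_le_ru continuousOn_e ⟨e_ru_neg.le, e_rd_pos.le⟩
  obtain ⟨r, hr, her⟩ := h
  refine ⟨r, hr, Prod.ext (θ_spec hr).2.2 ?_⟩
  unfold e at her
  show (traj r (θ r)).2 = Zloc r s0
  linarith

/-- **Theorem 1.1 at `γ = 5/3`, given Proposition 3.1 on the window.** If for every
`r ∈ [r_d, r_u]` the branch through `P_s` continues to the left (branch times `t > 0`) as a solution
of (1.8) off the sonic lines with `Z < W`, tending to `P_∞ = (0, 0)` (Prop. 3.1 of the paper), then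
`BuckmasterCaolaboraGomezserrano2025_thm11_monatomic` holds.
[cite: BuckmasterCaolaboraGomezserrano2025, §6 (proof of Theorem 1.1), Prop. 3.1, Prop. 4.1, Prop. 2.5] -/
theorem thm11_monatomic_of_left
    (hleft : ∀ r ∈ Icc rd ru, ∃ (Wl Zl : ℝ → ℝ) (δ : ℝ), 0 < δ ∧
      (∀ t ∈ Ico 0 δ, Wl t = Wloc r t ∧ Zl t = Zloc r t) ∧
      (∀ t ∈ Ioi (0 : ℝ), HasDerivAt (fun x => (Wl x, Zl x)) (field r (Wl t, Zl t)) t) ∧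
      (∀ t ∈ Ioi (0 : ℝ), 0 < DW (Wl t) (Zl t) ∧ 0 < DZ (Wl t) (Zl t) ∧ Zl t < Wl t) ∧
      Tendsto Wl atTop (𝓝 0) ∧ Tendsto Zl atTop (𝓝 0)) :
    BuckmasterCaolaboraGomezserrano2025_thm11_monatomic := by
  obtain ⟨r, hr, hmeet⟩ := exists_meeting
  obtain ⟨h1, h2, h3, h4, _⟩ := window hr
  obtain ⟨_, hgerm, hode, hΩ, _, _, _⟩ := traj_spec h1 h2
  obtain ⟨haθ, hθb, _⟩ := θ_spec hr
  obtain ⟨hs, hall, _⟩ := s0_spec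
  obtain ⟨hsρ, hsonic⟩ := hall r hr
  obtain ⟨Wl, Zl, δ, hδ, hbranch, hl, hloff, hlimW, hlimZ⟩ := hleft r hr
  have hprof := originProfile_analytic (r := r) one_pos
  exact thm11_monatomic_of_meeting h3 h4 (𝒲 := profile r 1) hprof.1 (by rw [hprof.2]; exact one_pos)
    haθ hθb (fun ξ hξ => by rw [hgerm ξ hξ]; rfl) hode hΩ hs hsρ hmeet
    (fun t ht => ⟨(hsonic t ht.1 ht.2).1, (hsonic t ht.1 ht.2).2.1, (hsonic t ht.1 ht.2).2.2.1⟩)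
    hδ hbranch hl hloff hlimW hlimZ

end Shooting

end Monatomic

end BuckmasterCaolaboraGomezserrano2025

end Literature.Analysis.FluidPDE
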